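import Literature.Computability.Complexity.BooleanFourier
import Literature.Computability.Complexity.LongCodeFourier
import Mathlib.Algebra.BigOperators.Fin
import Mathlib.Algebra.Ring.Commute
import Mathlib.Data.Fin.Tuple.Basic
import Mathlib.Data.Finset.Piecewise
import HarnessLib

/-!
# Walsh polynomials of the parity vector: a toolbox

Bookkeeping lemmas (finite sums only) for PARITY-VECTOR LAWS of tensors indexed by
`j ∈ ℕ^n` — the shape in which Bombieri's asymptotic sieve expresses the distribution of a
sifted sequence among the cells `Ω = j₁, …, Ω = j_n`: a main term times a *Walsh polynomial of
the parity vector* `W_θ(j) = ∑_{S ⊆ [n]} θ_S ∏_{i ∈ S} (-1)^{j_i + 1}`.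

* the parity character `∏_{i∈S} (-1)^{j_i+1}` is the Walsh character `χ_S(x)` of the cube point
  `x_i = [j_i even]` (`prod_neg_one_pow_succ_eq_walsh`), so the Fourier–Walsh machinery of
  `Literature/Computability/Complexity/BooleanFourier` and `…/LongCodeFourier` (characters
  `walsh`, coefficients `cubeFourierCoeff`, inversion, `|χ_S| = 1`, `∑_x χ_S(x)`) applies;
* a priori bounds `|W_θ(j)| ≤ 2^{n+1} - 1` for `θ_∅ = 1`, `|θ_S| ≤ 2` (`abs_walshSum_le`), the
  Dirac coefficients (`walshSum_dirac`), the cube mean of a Walsh polynomial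
  (`sum_cube_walshSum`);
* the POSITIVITY STEP (`exists_coeff_of_nonneg`): a non-negative function on the cube whose mean
  is `1 + O(η)` is, up to `η`, a Walsh polynomial with `θ_∅ = 1` exactly and `|θ_S| ≤ 2`;
* the MEAN STEP (`abs_sum_cube_sub_le`): if along one coordinate the two fibres of `f` are
  `λ(b) · W(x') + O(η)` with `λ(true) + λ(false) = 2` and `∑ W = 2^n`, then
  `∑ f = 2^{n+1} + O(2^{n+1} η)`;
* the CHAIN STEP (`abs_sub_rep_le`): if every coordinate section `m ↦ κ(j' with m inserted
  at i)` is, up to `η`, a function of the parity of `m`, then `κ(j)` is within `2(n+1)η` of its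
  value at the parity representative `r(j)_k ∈ {1, 2}`, `r(j)_k ≡ j_k (mod 2)`;
* small auxiliary facts: representatives of inserted tuples (`rep_insertNth`),
  `2n + 3 ≤ 2^{n+3}`, and the triangle inequality `abs_sub_main_le_of_section` that feeds a
  one-coordinate section law with the law of a sub-system.

All statements are elementary and proved; they are phrased without new definitions (explicit
sums), for direct use by the sieve-side parity-law files (`ParityWalshSections`).

References: E. Bombieri, *The asymptotic sieve*, Rend. Accad. Naz. XL (5) 1/2 (1975/76),
243–269 (parity vectors of sifted sequences); R. O'Donnell, *Analysis of Boolean Functions*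
(2014), Ch. 1 (Walsh expansion) [ODonnell2014].
-/

noncomputable section

open Finset
open Literature.Probability.RandomGraphs.LowDegree (sgn walsh walsh_empty sgn_true sgn_false)
open Literature.Computability.Complexity.LowDegree (cubeFourierCoeff sum_cubeFourierCoeff_mul_walsh
  cubeFourierCoeff_empty)
open Literature.Computability.Complexity.LongCode (abs_walsh sum_walsh)

namespace Literature.NumberTheory.Sieve.ParityWalsh

variable {n : ℕ}

/-! ## Parity characters are Walsh characters -/

/-- `(-1)^{m+1}` is the `±1`-sign (`sgn`, `true ↦ -1`) of the bit "`m` is even": `+1` for odd `m`,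
`-1` for even `m`. [folklore] -/
theorem neg_one_pow_succ_eq_sgn (m : ℕ) : (-1 : ℝ) ^ (m + 1) = sgn (decide (Even m)) := by
  rcases Nat.even_or_odd m with h | h
  · rw [pow_succ, h.neg_one_pow, decide_eq_true h, sgn_true]
    norm_num
  · rw [pow_succ, h.neg_one_pow, decide_eq_false (Nat.not_even_iff_odd.mpr h), sgn_false]
    norm_num

/-- The parity character `∏_{i ∈ S} (-1)^{j_i + 1}` of `j : Fin n → ℕ` is the Walsh character
`χ_S` of the cube point `(j_i even)_i`. [folklore] -/
theorem prod_neg_one_pow_succ_eq_walsh (S : Finset (Fin n)) (j : Fin n → ℕ) :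
    ∏ i ∈ S, (-1 : ℝ) ^ (j i + 1) = walsh S (fun i => decide (Even (j i))) :=
  Finset.prod_congr rfl fun i _ => neg_one_pow_succ_eq_sgn (j i)

/-- A Walsh polynomial of the parity vector is a Walsh polynomial on the cube, evaluated at the
parity pattern. [folklore] -/
theorem walshSum_eq_cube (θ : Finset (Fin n) → ℝ) (j : Fin n → ℕ) :
    ∑ S, θ S * ∏ i ∈ S, (-1 : ℝ) ^ (j i + 1) =
      ∑ S, θ S * walsh S (fun i => decide (Even (j i))) :=
  Finset.sum_congr rfl fun S _ => by rw [prod_neg_one_pow_succ_eq_walsh]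

/-- The parity pattern of the representative `k ↦ 2` (even) `/ 1` (odd) of a cube point is that
point. [folklore] -/
theorem decide_even_rep (x : Fin n → Bool) :
    (fun k => decide (Even (if x k then (2 : ℕ) else 1))) = x := by
  funext k
  cases x k <;> decide

/-! ## A priori bounds for normalised coefficients -/

/-- `∑_S |θ_S| ≤ 2^{n+1} - 1` when `θ_∅ = 1` and `|θ_S| ≤ 2` for all `S`. [folklore] -/
theorem sum_abs_coeff_le (θ : Finset (Fin n) → ℝ) (h0 : θ ∅ = 1) (hb : ∀ S, |θ S| ≤ 2) :
    ∑ S, |θ S| ≤ 2 ^ (n + 1) - 1 := by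
  rw [← Finset.add_sum_erase _ _ (Finset.mem_univ ∅), h0, abs_one]
  have hcard : ((Finset.univ : Finset (Finset (Fin n))).erase ∅).card = 2 ^ n - 1 := by
    rw [Finset.card_erase_of_mem (Finset.mem_univ _), Finset.card_univ, Fintype.card_finset,
      Fintype.card_fin]
  have h1 : ∑ S ∈ (Finset.univ : Finset (Finset (Fin n))).erase ∅, |θ S| ≤
      ((2 ^ n - 1 : ℕ) : ℝ) * 2 := by
    have h := Finset.sum_le_card_nsmul (((Finset.univ : Finset (Finset (Fin n))).erase ∅))
      (fun S => |θ S|) 2 (fun S _ => hb S)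
    rwa [hcard, nsmul_eq_mul] at h
  have h2 : ((2 ^ n - 1 : ℕ) : ℝ) = 2 ^ n - 1 := by
    rw [Nat.cast_sub Nat.one_le_two_pow, Nat.cast_pow, Nat.cast_two, Nat.cast_one]
  rw [h2] at h1
  rw [pow_succ]
  linarith

/-- `|W_θ(j)| = |∑_S θ_S ∏_{i∈S} (-1)^{j_i+1}| ≤ 2^{n+1} - 1` when `θ_∅ = 1`, `|θ_S| ≤ 2`.
[folklore] -/
theorem abs_walshSum_le (θ : Finset (Fin n) → ℝ) (h0 : θ ∅ = 1) (hb : ∀ S, |θ S| ≤ 2)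
    (j : Fin n → ℕ) : |∑ S, θ S * ∏ i ∈ S, (-1 : ℝ) ^ (j i + 1)| ≤ 2 ^ (n + 1) - 1 := by
  refine (Finset.abs_sum_le_sum_abs _ _).trans
    (le_trans (Finset.sum_le_sum fun S _ => ?_) (sum_abs_coeff_le θ h0 hb))
  rw [abs_mul, prod_neg_one_pow_succ_eq_walsh, abs_walsh, mul_one]

/-- With the Dirac coefficients `θ = 1_{S = ∅}` the Walsh polynomial is identically `1`.
[folklore] -/
theorem walshSum_dirac (j : Fin n → ℕ) :
    ∑ S : Finset (Fin n), (if S = ∅ then (1 : ℝ) else 0) * ∏ i ∈ S, (-1 : ℝ) ^ (j i + 1) = 1 := by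
  rw [Finset.sum_eq_single ∅ (fun S _ hS => by rw [if_neg hS, zero_mul])
    (fun h => absurd (Finset.mem_univ _) h)]
  simp

/-! ## Means over the cube -/

/-- The mean over the cube of a Walsh polynomial is its empty coefficient:
`∑_x ∑_S θ_S χ_S(x) = 2^n θ_∅`. [folklore] -/
theorem sum_cube_walshSum (θ : Finset (Fin n) → ℝ) :
    ∑ x : Fin n → Bool, ∑ S, θ S * walsh S x = 2 ^ n * θ ∅ := by
  rw [Finset.sum_comm]
  simp_rw [← Finset.mul_sum, sum_walsh, Fintype.card_fin, mul_ite, mul_zero]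
  rw [Finset.sum_eq_single ∅ (fun S _ hS => by rw [if_neg hS])
    (fun h => absurd (Finset.mem_univ _) h)]
  rw [if_pos rfl, mul_comm]

/-! ## The positivity step -/

/-- **Positivity step.** A non-negative function `f` on the cube `{0,1}^n` whose mean is within
`η ≤ 1` of `1` is within `η` (pointwise) of a Walsh polynomial `∑_S θ_S χ_S` with `θ_∅ = 1` EXACTLY
and `|θ_S| ≤ 2`: take the Fourier–Walsh coefficients of `f` (each bounded by the mean, as `f ≥ 0`)
and reset the empty one to `1`. [folklore] -/
theorem exists_coeff_of_nonneg {f : (Fin n → Bool) → ℝ} (hf : ∀ x, 0 ≤ f x) {η : ℝ} (hη : η ≤ 1)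
    (hmean : |(∑ x, f x) / 2 ^ n - 1| ≤ η) :
    ∃ θ : Finset (Fin n) → ℝ, θ ∅ = 1 ∧ (∀ S, |θ S| ≤ 2) ∧
      ∀ x, |∑ S, θ S * walsh S x - f x| ≤ η := by
  have hmean' : (∑ x, f x) / 2 ^ n ≤ 1 + η := by linarith [(abs_le.mp hmean).2]
  refine ⟨Function.update (cubeFourierCoeff f) ∅ 1, Function.update_self .., fun S => ?_,
    fun x => ?_⟩
  · by_cases hS : S = ∅
    · subst hS
      rw [Function.update_self, abs_one]
      norm_num
    · rw [Function.update_of_ne hS]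
      have h1 : |cubeFourierCoeff f S| ≤ (∑ x, f x) / 2 ^ n := by
        unfold cubeFourierCoeff
        rw [abs_div, abs_of_pos (by positivity : (0 : ℝ) < 2 ^ n)]
        refine div_le_div_of_nonneg_right ?_ (by positivity)
        refine (Finset.abs_sum_le_sum_abs _ _).trans (Finset.sum_le_sum fun x _ => ?_)
        rw [abs_mul, abs_of_nonneg (hf x), abs_walsh, mul_one]
      linarith
  · have key : ∑ S, (Function.update (cubeFourierCoeff f) ∅ 1 S - cubeFourierCoeff f S) *
        walsh S x = 1 - cubeFourierCoeff f ∅ := by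
      rw [Finset.sum_eq_single ∅
        (fun S _ hS => by rw [Function.update_of_ne hS, sub_self, zero_mul])
        (fun h => absurd (Finset.mem_univ _) h), Function.update_self, walsh_empty, mul_one]
    have hsplit : ∑ S, Function.update (cubeFourierCoeff f) ∅ 1 S * walsh S x =
        ∑ S, cubeFourierCoeff f S * walsh S x + (1 - cubeFourierCoeff f ∅) := by
      rw [← key, ← Finset.sum_add_distrib]
      exact Finset.sum_congr rfl fun S _ => by ring
    rw [hsplit, sum_cubeFourierCoeff_mul_walsh, cubeFourierCoeff_empty]
    rw [show f x + (1 - (∑ x, f x) / 2 ^ n) - f x = -((∑ x, f x) / 2 ^ n - 1) by ring, abs_neg]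
    exact hmean

/-! ## The mean step -/

/-- Splitting a sum over the cube `{0,1}^{n+1}` along the coordinate `i₀`. [folklore] -/
theorem sum_cube_succ (i₀ : Fin (n + 1)) (f : (Fin (n + 1) → Bool) → ℝ) :
    ∑ x, f x = ∑ x' : Fin n → Bool, (f (i₀.insertNth true x') + f (i₀.insertNth false x')) := by
  rw [← (Fin.insertNthEquiv (fun _ => Bool) i₀).sum_comp f, Fintype.sum_prod_type, Fintype.sum_bool,
    ← Finset.sum_add_distrib]
  rfl

/-- **Mean step.** If the two fibres of `f : {0,1}^{n+1} → ℝ` along a coordinate `i₀` are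
`λ_{x'}(b) · W(x') + O(η)` with `λ_{x'}(true) + λ_{x'}(false) = 2` and `∑_{x'} W(x') = 2^n`, then
`|∑_x f(x) - 2^{n+1}| ≤ 2^{n+1} η`. [folklore] -/
theorem abs_sum_cube_sub_le {f : (Fin (n + 1) → Bool) → ℝ} (i₀ : Fin (n + 1))
    {W : (Fin n → Bool) → ℝ} {lam : (Fin n → Bool) → Bool → ℝ} {η : ℝ}
    (hlam : ∀ x', lam x' true + lam x' false = 2)
    (hf : ∀ b x', |f (i₀.insertNth b x') - lam x' b * W x'| ≤ η)
    (hW : ∑ x', W x' = 2 ^ n) :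
    |∑ x, f x - 2 ^ (n + 1)| ≤ 2 ^ (n + 1) * η := by
  rw [sum_cube_succ i₀]
  have h2 : (2 : ℝ) ^ (n + 1) = ∑ x' : Fin n → Bool, 2 * W x' := by
    rw [← Finset.mul_sum, hW, pow_succ, mul_comm]
  have h2' : ∑ x' : Fin n → Bool, (f (i₀.insertNth true x') + f (i₀.insertNth false x')) -
        2 ^ (n + 1) =
      ∑ x' : Fin n → Bool, (f (i₀.insertNth true x') + f (i₀.insertNth false x') - 2 * W x') := by
    rw [h2, ← Finset.sum_sub_distrib]
  rw [h2']
  refine (Finset.abs_sum_le_sum_abs _ _).trans ?_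
  have hpt : ∀ x' : Fin n → Bool,
      |f (i₀.insertNth true x') + f (i₀.insertNth false x') - 2 * W x'| ≤ 2 * η := by
    intro x'
    have ht := hf true x'
    have hf' := hf false x'
    calc |f (i₀.insertNth true x') + f (i₀.insertNth false x') - 2 * W x'|
        = |(f (i₀.insertNth true x') - lam x' true * W x') +
            (f (i₀.insertNth false x') - lam x' false * W x')| := by
          rw [show (2 : ℝ) = lam x' true + lam x' false from (hlam x').symm]
          ring_nf
      _ ≤ |f (i₀.insertNth true x') - lam x' true * W x'| +
            |f (i₀.insertNth false x') - lam x' false * W x'| := abs_add_le _ _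
      _ ≤ η + η := add_le_add ht hf'
      _ = 2 * η := by ring
  calc ∑ x' : Fin n → Bool, |f (i₀.insertNth true x') + f (i₀.insertNth false x') - 2 * W x'|
      ≤ ∑ _x' : Fin n → Bool, 2 * η := Finset.sum_le_sum fun x' _ => hpt x'
    _ = 2 ^ (n + 1) * η := by
        rw [Finset.sum_const, Finset.card_univ, Fintype.card_fun, Fintype.card_bool,
          Fintype.card_fin, nsmul_eq_mul]
        push_cast
        ring

/-! ## The chain step -/

/-- One move of the chain: replacing the `i`-th coordinate of `g ∈ [1,v]^{n+1}` by a value of the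
same parity changes `κ` by at most `2η`, when every `i`-section of `κ` is within `η` of a quantity
`Λ_{i,j'}(m)` depending on `m` only through its parity. [folklore] -/
theorem abs_sub_update_le {v : ℕ} {κ : (Fin (n + 1) → ℕ) → ℝ}
    {Λ : Fin (n + 1) → (Fin n → ℕ) → ℕ → ℝ} {η : ℝ}
    (hΛ : ∀ i j' m m', m % 2 = m' % 2 → Λ i j' m = Λ i j' m')
    (hκ : ∀ (i : Fin (n + 1)) (j' : Fin n → ℕ), (∀ k, 1 ≤ j' k ∧ j' k ≤ v) →
      ∀ m : ℕ, 1 ≤ m → m ≤ v → |κ (i.insertNth m j') - Λ i j' m| ≤ η)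
    (g : Fin (n + 1) → ℕ) (hg : ∀ k, 1 ≤ g k ∧ g k ≤ v) (i : Fin (n + 1)) {m : ℕ} (hm1 : 1 ≤ m)
    (hmv : m ≤ v) (hpar : m % 2 = g i % 2) :
    |κ g - κ (Function.update g i m)| ≤ 2 * η := by
  have hg' : ∀ k, 1 ≤ i.removeNth g k ∧ i.removeNth g k ≤ v := fun k => hg _
  have h1 := hκ i (i.removeNth g) hg' (g i) (hg i).1 (hg i).2
  have h2 := hκ i (i.removeNth g) hg' m hm1 hmv
  rw [Fin.insertNth_self_removeNth] at h1
  rw [Fin.insertNth_removeNth, hΛ i _ m (g i) hpar] at h2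
  calc |κ g - κ (Function.update g i m)|
      = |(κ g - Λ i (i.removeNth g) (g i)) -
          (κ (Function.update g i m) - Λ i (i.removeNth g) (g i))| := by
        ring_nf
    _ ≤ |κ g - Λ i (i.removeNth g) (g i)| +
          |κ (Function.update g i m) - Λ i (i.removeNth g) (g i)| :=
        abs_sub _ _
    _ ≤ η + η := add_le_add h1 h2
    _ = 2 * η := by ring

/-- **Chain step.** Under the hypotheses of `abs_sub_update_le` with `v ≥ 2`, every `κ(j)`,
`j ∈ [1,v]^{n+1}`, is within `2(n+1)η` of `κ` at the parity representative
`r(j)_k = 2` (`j_k` even) `/ 1` (`j_k` odd): change one coordinate at a time. [folklore] -/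
theorem abs_sub_rep_le {v : ℕ} (hv : 2 ≤ v) {κ : (Fin (n + 1) → ℕ) → ℝ}
    {Λ : Fin (n + 1) → (Fin n → ℕ) → ℕ → ℝ} {η : ℝ}
    (hΛ : ∀ i j' m m', m % 2 = m' % 2 → Λ i j' m = Λ i j' m')
    (hκ : ∀ (i : Fin (n + 1)) (j' : Fin n → ℕ), (∀ k, 1 ≤ j' k ∧ j' k ≤ v) →
      ∀ m : ℕ, 1 ≤ m → m ≤ v → |κ (i.insertNth m j') - Λ i j' m| ≤ η)
    (j : Fin (n + 1) → ℕ) (hj : ∀ k, 1 ≤ j k ∧ j k ≤ v) :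
    |κ j - κ (fun k => if Even (j k) then 2 else 1)| ≤ 2 * (n + 1) * η := by
  set r : Fin (n + 1) → ℕ := fun k => if Even (j k) then 2 else 1 with hr
  have hr1 : ∀ k, 1 ≤ r k ∧ r k ≤ v := fun k => by
    simp only [hr]
    split_ifs <;> omega
  have hrpar : ∀ k, r k % 2 = j k % 2 := fun k => by
    simp only [hr]
    split_ifs with h
    · obtain ⟨c, hc⟩ := h
      omega
    · obtain ⟨c, hc⟩ := Nat.not_even_iff_odd.mp h
      omega
  have key : ∀ D : Finset (Fin (n + 1)), |κ j - κ (D.piecewise r j)| ≤ 2 * D.card * η := by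
    intro D
    induction D using Finset.induction_on with
    | empty => simp
    | insert i D hi ih =>
      rw [Finset.piecewise_insert, Finset.card_insert_of_notMem hi]
      have hg : ∀ k, 1 ≤ D.piecewise r j k ∧ D.piecewise r j k ≤ v := fun k => by
        by_cases hk : k ∈ D
        · rw [Finset.piecewise_eq_of_mem _ _ _ hk]; exact hr1 k
        · rw [Finset.piecewise_eq_of_notMem _ _ _ hk]; exact hj k
      have hpar : r i % 2 = D.piecewise r j i % 2 := by
        rw [Finset.piecewise_eq_of_notMem _ _ _ hi]; exact hrpar i
      have hstep := abs_sub_update_le hΛ hκ (D.piecewise r j) hg i (hr1 i).1 (hr1 i).2 hpar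
      calc |κ j - κ (Function.update (D.piecewise r j) i (r i))|
          ≤ |κ j - κ (D.piecewise r j)| +
              |κ (D.piecewise r j) - κ (Function.update (D.piecewise r j) i (r i))| :=
            abs_sub_le _ _ _
        _ ≤ 2 * D.card * η + 2 * η := add_le_add ih hstep
        _ = 2 * ((D.card + 1 : ℕ) : ℝ) * η := by push_cast; ring
  have h := key Finset.univ
  rw [Finset.piecewise_univ, Finset.card_univ, Fintype.card_fin] at h
  push_cast at h
  exact h

/-! ## Small auxiliary facts -/

/-- The parity representative of an inserted tuple is the inserted tuple of representatives.
[folklore] -/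
theorem rep_insertNth (i₀ : Fin (n + 1)) (b : Bool) (x' : Fin n → Bool) :
    (fun k => if (i₀.insertNth b x' : Fin (n + 1) → Bool) k then (2 : ℕ) else 1) =
      i₀.insertNth (if b then 2 else 1) (fun k => if x' k then 2 else 1) := by
  funext k
  refine Fin.succAboveCases i₀ ?_ (fun k => ?_) k
  · simp only [Fin.insertNth_apply_same]
  · simp only [Fin.insertNth_apply_succAbove]

/-- `2n + 3 ≤ 2^{n+3}` (real form). [folklore] -/
theorem two_mul_add_three_le_two_pow (n : ℕ) : (2 * n + 3 : ℝ) ≤ 2 ^ (n + 3) := by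
  have h : ((n + 1 : ℕ) : ℝ) ≤ ((2 ^ n : ℕ) : ℝ) := by exact_mod_cast n.lt_two_pow_self
  push_cast at h
  have h1 : (1 : ℝ) ≤ 2 ^ n := one_le_pow₀ (by norm_num)
  calc (2 * n + 3 : ℝ) ≤ 2 * 2 ^ n + 2 ^ n := by linarith
    _ ≤ 2 ^ (n + 3) := by rw [pow_add]; nlinarith

/-- **Triangle inequality of the induction step.** If `|C - λ a R F| ≤ E₁` (section law, ratio
`R = 𝔖/𝔖'`, fibre mass `F`), `|F - W · A 𝔖' P| ≤ E_t` (law of the sub-system), `R 𝔖' = 𝔖`,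
`|λ| ≤ 2`, `0 ≤ a ≤ a₊`, `0 ≤ R ≤ R₊`, then `|C - λ W (A 𝔖)(a P)| ≤ E₁ + 2 a₊ R₊ E_t`. [folklore] -/
theorem abs_sub_main_le_of_section {C lam a R F W A S S' P E₁ Et aB RB : ℝ}
    (h1 : |C - lam * a * R * F| ≤ E₁) (h2 : |F - W * (A * S' * P)| ≤ Et) (hRS : R * S' = S)
    (hlam : |lam| ≤ 2) (ha : 0 ≤ a) (haB : a ≤ aB) (hR : 0 ≤ R) (hRB : R ≤ RB) :
    |C - lam * W * (A * S) * (a * P)| ≤ E₁ + 2 * aB * RB * Et := by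
  have hEt : 0 ≤ Et := (abs_nonneg _).trans h2
  have key : C - lam * W * (A * S) * (a * P) =
      (C - lam * a * R * F) + lam * a * R * (F - W * (A * S' * P)) := by
    rw [← hRS]; ring
  rw [key]
  refine (abs_add_le _ _).trans (add_le_add h1 ?_)
  rw [abs_mul, abs_mul, abs_mul, abs_of_nonneg ha, abs_of_nonneg hR]
  have haB0 : 0 ≤ 2 * aB := mul_nonneg zero_le_two (ha.trans haB)
  have h3 : |lam| * a * R ≤ 2 * aB * RB :=
    mul_le_mul (mul_le_mul hlam haB ha zero_le_two) hRB hR haB0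
  exact mul_le_mul h3 h2 (abs_nonneg _) (mul_nonneg haB0 (hR.trans hRB))

end Literature.NumberTheory.Sieve.ParityWalsh

end
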